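import Literature.NumberTheory.EllipticCurves.QuadraticTwistLocalDataAtTwoPadicGlueProofs
import HarnessLib

/-!
# Boxer–Diao 2010, proof of Prop. 4.1 at the prime `2`: `c₂(E^{(d)}) = 1` for a good
# (supersingular at `2`) curve `y² + y = x³ + a₂x² + a₄x + a₆` and every `d` with `4 ∤ d` (proofs)

`Proofs` file (theorems only: no definition, no named fact, no instance), topic
`Literature/NumberTheory/EllipticCurves`, namespace `Literature.NumberTheory.EllipticCurves.BoxerDiao2010`.

G. Boxer, P. Diao, *2-Selmer groups of quadratic twists of elliptic curves*, Proc. AMS 138 (2010),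
proof of Prop. 4.1 (pp. 1976–1977): "Next we consider the prime `2`. We claim that `c₂` is always
`1`. By assumption, `E` has a minimal Weierstrass model of the form
`E : y² + y = x³ + a₂x² + a₄x + a₆`." — `d` even: "the algorithm terminates at step 3 … `E^{(d)}` has
Kodaira symbol II at `2` and `c₂ = 1`"; `d ≡ 1 (mod 4)`: "`E^{(d)}` has good reduction at `2` and
thus `c₂ = 1`"; `d ≡ 3 (mod 4)`: "we end up in step 10 … `E^{(d)}` has Kodaira symbol II* at `2`
and `c₂ = 1`".

For an integer equation `M = (0, a₂, 1, a₄, a₆)` (whose discriminant is odd) this is exactly the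
SUPERSINGULAR branch (`a₁ = 0`) of the tree's symbolic run of Tate's algorithm over `ℤ₂` on the
models of the quadratic twist (`QuadraticTwistGoodReductionCharTwoSupersingularProofs`:
`kodairaSymbolOfMinimal_twistGoodSupersingular_three` — type `II*`, `…_two` — type `II`; the
unramified class `d ≡ 1 (mod 4)` by `kodairaSymbol_and_localTamagawaNumber_quadraticTwist_of_one_mod_four`),
read as a local Tamagawa number by `kodairaSymbol_and_localTamagawaNumber_of_model_padic`
(`QuadraticTwistLocalDataAtTwoPadicGlueProofs`; Silverman *ATAEC* IV.9.4 Steps 3 and 10: `c = 1`).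
This file only assembles these for the model `M ⊗ ℤ₂` and an integer `d ≢ 0 (mod 4)`:
`localTamagawaNumber_two_quadraticTwist_model_eq_one`.

## References

* G. Boxer, P. Diao, *2-Selmer groups of quadratic twists of elliptic curves*, Proc. Amer. Math.
  Soc. 138 (2010) 1969–1978, proof of Prop. 4.1 (pp. 1976–1977). [BoxerDiao2010]
* J. H. Silverman, *Advanced Topics in the Arithmetic of Elliptic Curves* (1994), IV.9.4 Steps 1,
  3, 10 (PDF pp. 344–346). [SilvermanATAEC1994]
-/

noncomputable section

open scoped Classical

open IsLocalRing Literature.NumberTheory.DiophantineGeometry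
  Literature.NumberTheory.DiophantineGeometry.TateAlgorithm

namespace Literature.NumberTheory.EllipticCurves

namespace BoxerDiao2010

open TwistGoodTwo

/-- The discriminant of `M = (0, a₂, 1, a₄, a₆)` is odd: `Δ ≡ −27 b₆² ≡ 1 (mod 2)` since
`b₂ = 4a₂`, `b₄ = 2a₄` are even and `b₆ = 1 + 4a₆` is odd (so the curve has good reduction at `2`;
Boxer–Diao 2010, p. 1971 Remark: condition (4) "is equivalent to `E` having a minimal model
`y² + y = x³ + a₂x² + a₄x + a₆`"). [cite: BoxerDiao2010, p. 1971 Remark] -/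
theorem odd_Δ_of_a₁_eq_zero_of_a₃_eq_one (M : WeierstrassCurve ℤ) (hM1 : M.a₁ = 0)
    (hM3 : M.a₃ = 1) : Odd M.Δ := by
  refine ⟨8 * M.a₂ ^ 2 * M.a₄ ^ 2 - 32 * M.a₄ ^ 3 - 8 * M.a₂ ^ 3 * (4 * M.a₆ + 1) +
    36 * M.a₂ * M.a₄ * (4 * M.a₆ + 1) - 14 * (4 * M.a₆ + 1) ^ 2 + (8 * M.a₆ ^ 2 + 4 * M.a₆), ?_⟩
  simp only [WeierstrassCurve.Δ, WeierstrassCurve.b₂, WeierstrassCurve.b₄, WeierstrassCurve.b₆,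
    WeierstrassCurve.b₈, hM1, hM3]
  ring

/-- **`c₂(E^{(d)}) = 1` for `E : y² + y = x³ + a₂x² + a₄x + a₆` and `4 ∤ d`** (Boxer–Diao 2010,
proof of Prop. 4.1, pp. 1976–1977: `d` even — Kodaira symbol II, `c₂ = 1`; `d ≡ 1 (mod 4)` — good
reduction, `c₂ = 1`; `d ≡ 3 (mod 4)` — Kodaira symbol II*, `c₂ = 1`). Here `E / ℚ₂` is the base
change of the `ℤ₂`-model `M ⊗ ℤ₂` (`M = (0, a₂, 1, a₄, a₆)` integral, odd discriminant, `a₁ = 0`: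
supersingular good reduction at `2`) and `E^{(d)}` is the tree's `WeierstrassCurve.quadraticTwist`;
the three cases are the supersingular rows of the tree's symbolic Tate algorithm at `2`
(`kodairaSymbolOfMinimal_twistGoodSupersingular_two/_three`, type II / II*, `c = 1` by
`kodairaSymbol_and_localTamagawaNumber_of_model_padic`; `d ≡ 1 (mod 4)` by
`kodairaSymbol_and_localTamagawaNumber_quadraticTwist_of_one_mod_four`).
[cite: BoxerDiao2010, proof of Prop. 4.1 (pp. 1976–1977)]
[cite: SilvermanATAEC1994, IV.9.4 Steps 1, 3, 10 (PDF pp. 344–346)] -/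
theorem localTamagawaNumber_two_quadraticTwist_model_eq_one (M : WeierstrassCurve ℤ)
    (hM1 : M.a₁ = 0) (hM3 : M.a₃ = 1) {d : ℤ} (hd : ¬ (4 : ℤ) ∣ d) :
    (((M.map (Int.castRingHom ℤ_[2])).baseChange ℚ_[2]).quadraticTwist (d : ℚ_[2])).localTamagawaNumber
      ℤ_[2] = 1 := by
  haveI := perfectField_residueField_padicInt
  obtain ⟨ε, hεu, hε⟩ := exists_isUnit_two_eq_uniformizer_mul_padicInt
  set V : WeierstrassCurve ℤ_[2] := M.map (Int.castRingHom ℤ_[2]) with hV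
  have hV1 : V.a₁ = 0 := by simp [hV, hM1]
  have hVΔ : IsUnit V.Δ := by
    rw [hV, WeierstrassCurve.map_Δ, eq_intCast, PadicInt.isUnit_iff]
    refine le_antisymm (PadicInt.norm_le_one _) (not_lt.mp fun hlt => ?_)
    have h2 : (2 : ℤ) ∣ M.Δ := by exact_mod_cast (PadicInt.norm_int_lt_one_iff_dvd M.Δ).mp hlt
    exact (Int.not_even_iff_odd.mpr (odd_Δ_of_a₁_eq_zero_of_a₃_eq_one M hM1 hM3))
      (even_iff_two_dvd.mpr h2)
  set E : WeierstrassCurve ℚ_[2] := V.baseChange ℚ_[2] with hE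
  have hΔE : E.Δ ≠ 0 := by
    rw [hE, WeierstrassCurve.baseChange, WeierstrassCurve.map_Δ]
    exact (map_ne_zero_iff _ (IsFractionRing.injective ℤ_[2] ℚ_[2])).mpr hVΔ.ne_zero
  haveI : E.IsElliptic := (WeierstrassCurve.isElliptic_iff _).mpr (Ne.isUnit hΔE)
  have hVE : (1 : WeierstrassCurve.VariableChange ℚ_[2]) • E = V.baseChange ℚ_[2] := one_smul _ _
  have hd0 : (d : ℚ_[2]) ≠ 0 := by
    have : (d : ℤ) ≠ 0 := fun h => hd (h ▸ dvd_zero 4)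
    exact_mod_cast this
  haveI := WeierstrassCurve.isElliptic_quadraticTwist E hd0
  -- `d mod 4 ∈ {1, 2, 3}`
  have hcases : (∃ k : ℤ, d = 4 * k + 1) ∨ (∃ k : ℤ, d = 4 * k + 3) ∨ (∃ k : ℤ, d = 4 * k + 2) := by
    have h4 : d % 4 ≠ 0 := fun h => hd (Int.dvd_of_emod_eq_zero h)
    rcases (by omega : d % 4 = 1 ∨ d % 4 = 3 ∨ d % 4 = 2) with h | h | h
    · exact Or.inl ⟨d / 4, by omega⟩
    · exact Or.inr (Or.inl ⟨d / 4, by omega⟩)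
    · exact Or.inr (Or.inr ⟨d / 4, by omega⟩)
  rcases hcases with ⟨k, hk⟩ | ⟨k, hk⟩ | ⟨k, hk⟩
  · -- `d ≡ 1 (mod 4)`: good reduction persists
    exact (kodairaSymbol_and_localTamagawaNumber_quadraticTwist_of_one_mod_four hε E V hVΔ 1
      hVE hk).2
  · -- `d ≡ 3 (mod 4)`: type II*
    obtain ⟨hK, -, -⟩ := kodairaSymbolOfMinimal_twistGoodSupersingular_three hε hεu V hV1 hVΔ hk
    obtain ⟨C, hC⟩ := smul_quadraticTwist_eq_modelThree' (K := ℚ_[2]) hε hεu V hV1 d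
    obtain ⟨-, hc, -⟩ := kodairaSymbol_and_localTamagawaNumber_of_model_padic _ _ C hC
      (by rw [hK]; decide)
    exact hc (Or.inr hK)
  · -- `d ≡ 2 (mod 4)`: type II
    have hd₁ : (2 * k + 1 : ℤ) = 2 * k + 1 := rfl
    obtain ⟨hK, -, -⟩ := kodairaSymbolOfMinimal_twistGoodSupersingular_two hε hεu V hV1 hVΔ hd₁
    have hdd : ((d : ℤ) : ℚ_[2]) = ((2 * (2 * k + 1) : ℤ) : ℚ_[2]) := by rw [hk]; push_cast; ring
    have hC : (1 : WeierstrassCurve.VariableChange ℚ_[2]) • (E.quadraticTwist (d : ℚ_[2])) =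
        (⟨0, 2 * ((2 * k + 1 : ℤ) : ℤ_[2]) * V.a₂, 0, 4 * ((2 * k + 1 : ℤ) : ℤ_[2]) ^ 2 * V.a₄,
          2 * ((2 * k + 1 : ℤ) : ℤ_[2]) ^ 3 * (V.a₃ ^ 2 + 4 * V.a₆)⟩ :
            WeierstrassCurve ℤ_[2]).baseChange ℚ_[2] := by
      rw [one_smul, hdd]
      exact quadraticTwist_eq_modelTwo' hε hεu V hV1 (2 * k + 1)
    obtain ⟨-, hc, -⟩ := kodairaSymbol_and_localTamagawaNumber_of_model_padic _ _ 1 hC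
      (by rw [hK]; decide)
    exact hc (Or.inl hK)

end BoxerDiao2010

end Literature.NumberTheory.EllipticCurves

end
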